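import Mathlib.NumberTheory.AbelSummation
import Mathlib.NumberTheory.Chebyshev
import Literature.NumberTheory.LFunctions.WeilMarkovQuadratic
import HarnessLib

/-!
# rh-explicit (venture WeilGRH): THE FLAT PRIME SUM OF A WINDOW UNDER A CHEBYSHEV–SYLVESTER BOUND
  `ψ(t) ≤ c·t + d·√t` — `S(a) ≤ c·(2(eᵃ − 1)/a − 1) + d·(1 + a/2)`, unconditionally usable (`c = 1.0722`, `d = 7`)

Cell `rh-explicit`, WEIL TRACK (structure seat weil-3, gen11).  Hypothesis-parametric, RH-free real analysis; the
two-term companion of `FlatSumChebyshev.lean` (`ψ(t) ≤ c·t ⟹ S(a) ≤ c(2(eᵃ−1)/a − 1)`, usable under RH with `c = 1.04`).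
With the UNCONDITIONAL Chebyshev–Sylvester bound of the tree (`ChebyshevSylvesterPsi.psi_le_sylvester`:
`ψ(x) ≤ 1.0722x + 7√x` for all `x ≥ 0`) the flat prime sum `S(a) = Σ_{log n<2a}Λ(n)n^{-1/2}(1 − log n/2a)` of a window
obeys an explicit bound with no hypothesis on `ζ`, which is what a GRH(χ)-only statement about `L(s,χ)` needs
(`CharCentralOrderExplicit.lean`):

* **`flatSum_le_of_psi_le_add_sqrt`**: if `ψ(t) ≤ c·t + d·√t` for all `t ≥ 0`, then for every `a > 0`

    `Σ_{log n < 2a} Λ(n) n^{-1/2}(1 − log n/(2a)) ≤ c·(2(eᵃ − 1)/a − 1) + d·(1 + a/2)`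

  (Abel summation with `w(t) = (1 − log t/2a)/√t`; `∫₁^{e^{2a}} t(−w′) = 2(eᵃ−1)/a − 1` and
  `∫₁^{e^{2a}} √t(−w′) = 1 + a/2`, primitive `(1/2a + 1/2)log t − (log t)²/(8a)`);

No definitions, no named facts; RH-free (the Chebyshev–Sylvester bound is a hypothesis).
-/

set_option autoImplicit false

noncomputable section

open Finset MeasureTheory
open scoped Real Topology Chebyshev ArithmeticFunction.vonMangoldt

namespace Summit.Ventures.WeilGRH

open Literature.NumberTheory.LFunctions

/-! ## The weight `w(t) = (1 − log t/L)/√t` and a primitive of `t ↦ t·(−w′(t))` -/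

/-- `w′(t) = −(1/L + (1 − log t/L)/2)/(t√t)` for `t > 0`. -/
private theorem hasDerivAt_w (L : ℝ) {t : ℝ} (ht : 0 < t) :
    HasDerivAt (fun s : ℝ ↦ (1 - Real.log s / L) / Real.sqrt s)
      (-((1 / L + (1 - Real.log t / L) / 2) / (t * Real.sqrt t))) t := by
  have hs : 0 < Real.sqrt t := Real.sqrt_pos.2 ht
  have h1 : HasDerivAt (fun s : ℝ ↦ 1 - Real.log s / L) (-(t⁻¹ / L)) t := by
    simpa using ((Real.hasDerivAt_log ht.ne').div_const L).const_sub 1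
  have h2 : HasDerivAt (fun s : ℝ ↦ Real.sqrt s) (1 / (2 * Real.sqrt t)) t := Real.hasDerivAt_sqrt ht.ne'
  have h := h1.div h2 hs.ne'
  refine h.congr_deriv ?_
  have hss2 : Real.sqrt t ^ 2 = t := Real.sq_sqrt ht.le
  field_simp
  rw [hss2]
  ring

/-- `d/dt[√t·(1 − log t/L + 4/L)] = (1/L + (1 − log t/L)/2)/√t` for `t > 0`. -/
private theorem hasDerivAt_G (L : ℝ) {t : ℝ} (ht : 0 < t) :
    HasDerivAt (fun s : ℝ ↦ Real.sqrt s * (1 - Real.log s / L + 4 / L))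
      ((1 / L + (1 - Real.log t / L) / 2) / Real.sqrt t) t := by
  have h1 : HasDerivAt (fun s : ℝ ↦ 1 - Real.log s / L + 4 / L) (-(t⁻¹ / L)) t := by
    simpa using (((Real.hasDerivAt_log ht.ne').div_const L).const_sub 1).add_const (4 / L)
  have h2 : HasDerivAt (fun s : ℝ ↦ Real.sqrt s) (1 / (2 * Real.sqrt t)) t := Real.hasDerivAt_sqrt ht.ne'
  have h := h2.mul h1
  refine h.congr_deriv ?_
  have hss2 : Real.sqrt t ^ 2 = t := Real.sq_sqrt ht.le
  field_simp
  rw [hss2]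
  ring

/-- `d/dt[(1/L + 1/2)·log t − (log t)²/(4L)] = (1/L + (1 − log t/L)/2)/t` for `t > 0` (primitive of `√t·(−w′)`). -/
private theorem hasDerivAt_H (L : ℝ) {t : ℝ} (ht : 0 < t) :
    HasDerivAt (fun s : ℝ ↦ (1 / L + 1 / 2) * Real.log s - Real.log s ^ 2 / (4 * L))
      ((1 / L + (1 - Real.log t / L) / 2) / t) t := by
  have h1 : HasDerivAt (fun s : ℝ ↦ (1 / L + 1 / 2) * Real.log s) ((1 / L + 1 / 2) * t⁻¹) t :=
    (Real.hasDerivAt_log ht.ne').const_mul _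
  have h2 : HasDerivAt (fun s : ℝ ↦ Real.log s ^ 2 / (4 * L)) (2 * Real.log t * t⁻¹ / (4 * L)) t := by
    have := (Real.hasDerivAt_log ht.ne').pow 2
    simpa using this.div_const (4 * L)
  refine (h1.sub h2).congr_deriv ?_
  field_simp
  ring

/-! ## The window sum as a sum over `k ≤ ⌊e^{2a}⌋` -/

/-- **`S(a) = Σ_{k ≤ ⌊e^{2a}⌋} Λ(k)·(1 − log k/2a)/√k`**: the members of `range(⌊e^{2a}⌋+1)` with `log n ≥ 2a` are
`n = e^{2a}` only, where the weight vanishes. -/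
private theorem flatSum_eq_sum_Icc' {a : ℝ} (ha : 0 < a) :
    ∑ n ∈ weilPrimeIndex a, (Λ n : ℝ) / Real.sqrt n * (1 - Real.log n / (2 * a)) =
      ∑ k ∈ Icc 0 ⌊Real.exp (2 * a)⌋₊, (1 - Real.log k / (2 * a)) / Real.sqrt k * (Λ k : ℝ) := by
  unfold weilPrimeIndex
  rw [Finset.sum_filter, Nat.range_succ_eq_Icc_zero]
  refine Finset.sum_congr rfl fun k hk ↦ ?_
  split_ifs with h
  · ring
  · rcases Nat.eq_zero_or_pos k with rfl | hk0
    · simp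
    · have hkx : (k : ℝ) ≤ Real.exp (2 * a) :=
        (Nat.le_floor_iff (Real.exp_pos _).le).1 (Finset.mem_Icc.1 hk).2
      have hlog : Real.log k ≤ 2 * a := by
        have := Real.log_le_log (by exact_mod_cast hk0) hkx
        rwa [Real.log_exp] at this
      have heq : Real.log k = 2 * a := le_antisymm hlog (not_lt.1 h)
      rw [heq, div_self (by linarith), sub_self, zero_div, zero_mul]

/-! ## Abel summation against a two-term Chebyshev–Sylvester bound -/

/-- **THE FLAT PRIME SUM AGAINST `ψ(t) ≤ c·t + d·√t`**: if `ψ(t) ≤ c·t + d·√t` for every `t ≥ 0`, then for every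
`a > 0`

  `Σ_{log n < 2a} Λ(n) n^{-1/2} (1 − log n/(2a)) ≤ c·(2(eᵃ − 1)/a − 1) + d·(1 + a/2)`.

(Abel summation with `w(t) = (1 − log t/2a)/√t`, `w(e^{2a}) = 0`; `S(a) = ∫₁^{e^{2a}} ψ·(−w′) ≤ ∫ (ct + d√t)(−w′)`;
primitives `√t(1 − log t/2a + 2/a)` of `t(−w′)` and `(1/2a + 1/2)log t − (log t)²/(8a)` of `√t(−w′)`.) -/
theorem flatSum_le_of_psi_le_add_sqrt {c d : ℝ}
    (hψ : ∀ t : ℝ, 0 ≤ t → ψ t ≤ c * t + d * Real.sqrt t) {a : ℝ} (ha : 0 < a) :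
    ∑ n ∈ weilPrimeIndex a, (Λ n : ℝ) / Real.sqrt n * (1 - Real.log n / (2 * a)) ≤
      c * (2 * (Real.exp a - 1) / a - 1) + d * (1 + a / 2) := by
  rw [flatSum_eq_sum_Icc' ha]
  set L : ℝ := 2 * a with hL
  set x : ℝ := Real.exp L with hx
  have hL0 : 0 < L := by rw [hL]; linarith
  have hx1 : 1 ≤ x := by rw [hx]; exact Real.one_le_exp (by linarith)
  have hlogx : Real.log x = L := by rw [hx, Real.log_exp]
  have hsqrtx : Real.sqrt x = Real.exp a := by
    rw [hx, hL, show 2 * a = a + a by ring, Real.exp_add, Real.sqrt_mul_self (Real.exp_pos a).le]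
  -- the weight, its derivative, and the primitives
  set w : ℝ → ℝ := fun s ↦ (1 - Real.log s / L) / Real.sqrt s with hw
  set w' : ℝ → ℝ := fun t ↦ -((1 / L + (1 - Real.log t / L) / 2) / (t * Real.sqrt t)) with hw'
  set G : ℝ → ℝ := fun s ↦ Real.sqrt s * (1 - Real.log s / L + 4 / L) with hG
  set H : ℝ → ℝ := fun s ↦ (1 / L + 1 / 2) * Real.log s - Real.log s ^ 2 / (4 * L) with hH
  -- the comparison integrand `K(t) = c·G′(t) + d·H′(t) = (ct + d√t)(−w′(t))`
  set K : ℝ → ℝ := fun t ↦ c * ((1 / L + (1 - Real.log t / L) / 2) / Real.sqrt t) +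
    d * ((1 / L + (1 - Real.log t / L) / 2) / t) with hK
  have hderiv : ∀ t : ℝ, 0 < t → HasDerivAt w (w' t) t := fun t ht ↦ hasDerivAt_w L ht
  have hdiff : ∀ t ∈ Set.Icc 1 x, DifferentiableAt ℝ w t :=
    fun t ht ↦ (hderiv t (by linarith [ht.1])).differentiableAt
  have hderiv_eq : ∀ t : ℝ, 0 < t → deriv w t = w' t := fun t ht ↦ (hderiv t ht).deriv
  -- continuity on `(0, ∞)`
  have hcontAt : ∀ t : ℝ, 0 < t → ContinuousAt w' t ∧ ContinuousAt K t := by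
    intro t ht
    have h1 : ContinuousAt Real.log t := Real.continuousAt_log ht.ne'
    have h2 : ContinuousAt Real.sqrt t := Real.continuous_sqrt.continuousAt
    have hnum : ContinuousAt (fun s : ℝ ↦ 1 / L + (1 - Real.log s / L) / 2) t :=
      continuousAt_const.add ((continuousAt_const.sub (h1.div_const L)).div_const 2)
    have hs0 : Real.sqrt t ≠ 0 := (Real.sqrt_pos.2 ht).ne'
    exact ⟨(hnum.div (continuousAt_id.mul h2) (mul_ne_zero ht.ne' hs0)).neg,
      ((hnum.div h2 hs0).const_mul c).add ((hnum.div continuousAt_id ht.ne').const_mul d)⟩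
  have hcont : ContinuousOn w' (Set.Icc 1 x) :=
    fun t ht ↦ ((hcontAt t (by linarith [ht.1])).1).continuousWithinAt
  have hint' : IntegrableOn w' (Set.Icc 1 x) := hcont.integrableOn_Icc
  have hint : IntegrableOn (deriv w) (Set.Icc 1 x) :=
    hint'.congr_fun (fun t ht ↦ (hderiv_eq t (by linarith [ht.1])).symm) measurableSet_Icc
  -- Abel summation
  have habel := sum_mul_eq_sub_integral_mul₀ (fun k ↦ (Λ k : ℝ)) (by simp) x hdiff hint
  have hS : (∑ k ∈ Icc 0 ⌊x⌋₊, (1 - Real.log k / L) / Real.sqrt k * (Λ k : ℝ)) =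
      ∑ k ∈ Icc 0 ⌊x⌋₊, w k * (Λ k : ℝ) := rfl
  have hwx : w x = 0 := by
    show (1 - Real.log x / L) / Real.sqrt x = 0
    rw [hlogx, div_self hL0.ne', sub_self, zero_div]
  rw [hS, habel, hwx, zero_mul, zero_sub]
  have hI : ∫ t in Set.Ioc 1 x, deriv w t * ∑ k ∈ Icc 0 ⌊t⌋₊, (Λ k : ℝ) =
      ∫ t in Set.Ioc 1 x, w' t * ψ t :=
    setIntegral_congr_fun measurableSet_Ioc fun t ht ↦ by
      rw [hderiv_eq t (by linarith [ht.1]), Chebyshev.psi_eq_sum_Icc]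
  rw [hI, ← integral_neg]
  -- integrability on `(1, x]`
  have hIψ : IntegrableOn (fun t : ℝ ↦ w' t * ψ t) (Set.Ioc 1 x) := by
    have h := (integrableOn_mul_sum_Icc (fun k ↦ (Λ k : ℝ)) (m := 0) zero_le_one hint').mono_set
      Set.Ioc_subset_Icc_self
    exact h.congr_fun (fun t _ ↦ by rw [Chebyshev.psi_eq_sum_Icc]) measurableSet_Ioc
  have hKcont : ContinuousOn K (Set.Icc 1 x) := fun t ht ↦ ((hcontAt t (by linarith [ht.1])).2).continuousWithinAt
  have hIK : IntegrableOn K (Set.Ioc 1 x) := hKcont.integrableOn_Icc.mono_set Set.Ioc_subset_Icc_self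
  -- pointwise comparison on `(1, x]`
  have hpt : ∀ t ∈ Set.Ioc 1 x, -(w' t * ψ t) ≤ K t := by
    intro t ht
    have ht0 : 0 < t := by linarith [ht.1]
    have hs : 0 < Real.sqrt t := Real.sqrt_pos.2 ht0
    have hss : Real.sqrt t * Real.sqrt t = t := Real.mul_self_sqrt ht0.le
    have hlogt : Real.log t ≤ L := by rw [← hlogx]; exact Real.log_le_log ht0 ht.2
    have hnum : 0 ≤ 1 / L + (1 - Real.log t / L) / 2 := by
      have : 0 ≤ 1 - Real.log t / L := by rw [sub_nonneg, div_le_one hL0]; exact hlogt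
      positivity
    have hKw : 0 ≤ (1 / L + (1 - Real.log t / L) / 2) / (t * Real.sqrt t) := by positivity
    have hψt := hψ t ht0.le
    have e1 : -(w' t * ψ t) = (1 / L + (1 - Real.log t / L) / 2) / (t * Real.sqrt t) * ψ t := by
      rw [hw']; ring
    have e2 : K t = (1 / L + (1 - Real.log t / L) / 2) / (t * Real.sqrt t) * (c * t + d * Real.sqrt t) := by
      rw [hK]
      field_simp
    rw [e1, e2]
    exact mul_le_mul_of_nonneg_left hψt hKw
  have hmono : ∫ t in Set.Ioc 1 x, -(w' t * ψ t) ≤ ∫ t in Set.Ioc 1 x, K t :=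
    setIntegral_mono_on hIψ.neg hIK measurableSet_Ioc hpt
  refine hmono.trans (le_of_eq ?_)
  -- `∫₁^x K = c(G x − G 1) + d(H x − H 1)`
  have hK' : ∀ t ∈ Set.uIcc 1 x, HasDerivAt (fun s ↦ c * G s + d * H s) (K t) t := by
    intro t ht
    rw [Set.uIcc_of_le hx1] at ht
    have ht0 : 0 < t := by linarith [ht.1]
    exact ((hasDerivAt_G L ht0).const_mul c).add ((hasDerivAt_H L ht0).const_mul d)
  have hKcont' : ContinuousOn K (Set.uIcc 1 x) := by rwa [Set.uIcc_of_le hx1]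
  have hFTC : ∫ t in Set.Ioc 1 x, K t = (c * G x + d * H x) - (c * G 1 + d * H 1) := by
    rw [← intervalIntegral.integral_of_le hx1]
    exact intervalIntegral.integral_eq_sub_of_hasDerivAt hK' hKcont'.intervalIntegrable
  have hGval : G x - G 1 = 2 * (Real.exp a - 1) / a - 1 := by
    show Real.sqrt x * (1 - Real.log x / L + 4 / L) - Real.sqrt 1 * (1 - Real.log 1 / L + 4 / L) =
      2 * (Real.exp a - 1) / a - 1
    rw [hsqrtx, hlogx, Real.sqrt_one, Real.log_one, hL]
    field_simp
    ring
  have hHval : H x - H 1 = 1 + a / 2 := by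
    show (1 / L + 1 / 2) * Real.log x - Real.log x ^ 2 / (4 * L) -
        ((1 / L + 1 / 2) * Real.log 1 - Real.log 1 ^ 2 / (4 * L)) = 1 + a / 2
    rw [hlogx, Real.log_one, hL]
    field_simp
    ring
  rw [hFTC]
  linear_combination c * hGval + d * hHval

end Summit.Ventures.WeilGRH

end
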